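import Summits.BirchSwinnertonDyer.BirchSwinnertonDyer.Theorems.SignedLowerHalvesSmallImageLowerHalfBothSignsRttCharRoadFormalModuleLocalPoints
import Summits.BirchSwinnertonDyer.BirchSwinnertonDyer.Theorems.SchneiderFreeAdditiveX3QuadraticGoodReductionDescent
import Summits.BirchSwinnertonDyer.Rank1Residual.Additive.KobayashiLayerSaturation
import Literature.NumberTheory.EllipticCurves.LocalKernelOfReductionGaloisTransportProofs
import HarnessLib

/-!
# Route `SignedLowerHalves`, crux L `SmallImageLowerHalfBothSigns` (stmt-BirchSwinnertonDyer-23599), line `rtt_w3` v12 — row B5-pts of INJ_top,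
# formal-group lane, LAST BRICK: THE FORMAL `𝒪_{K_v}`-MODULE LIVES ON THE KERNEL OF REDUCTION `E₁(K̄_v)`, which is `p`-saturated with
# torsion quotient — so the Kummer data of Kobayashi's `E^ε(K_n·K_v)` are stable under every `[b]`, `b ∈ 𝒪_{K_v}` (`hstab` of D3-c fires)

Hand `bsd-inputs-honda-p1` g20 (LEAD `cruxlead-stmt-BirchSwinnertonDyer-23599` g7, D3-c owner `bsd-line-slh-p3-w3` g17); helper `--supports 23599`;
THEOREMS ONLY (no definition, no named fact, no instance, no `sorry`).  BSD / crux L / INJ_top / D3-c are NOT proved here.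

`…RttCharRoadFormalModuleLocalPoints.exists_formalModule_localPoints_of_model` (p767396) produced, from the local `ℤ_p`-model data at the inert
`v` (`F = K_v ≅ ℚ_{p²}`), a subgroup `E₁ ≤ E(K̄_v)` with the formal `𝒪_{K_v}`-action `act`, characterised by the NORM CRITERION «`(x, y) ∈ E₁ ↔ ‖x‖ > 1`»
for coordinates in a finite `E ⊆ K̄_v` with the spectral norm of the Lubin–Tate files (local instance `nE`).  `…RttCharRoadKummerStability`
(p765177) needs, besides `act`/`hact`/`hu`, that `E₁` is `p`-SATURATED (`hsat`) with `E(K̄_v)/E₁` TORSION (`htor`) — known in the tree for the kernel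
of reduction `WeierstrassCurve.localKernelOfReduction` at a good supersingular place (`mem_localKernelOfReduction_of_prime_nsmul_mem`,
`exists_nsmul_mem_localKernelOfReduction`).  This file identifies the two:

* §1 (B-a1) `one_lt_norm_iff_one_lt_spectralValuation` — the spectral norm `nE` of the Lubin–Tate files and the tree's `spectralValuation` on
  `K̄_v` have the same closed unit ball (both are the integral closure of `𝒪_v`: `mem_absIntegers_iff_spectralNorm_le_one` for the local norm
  `nF`, whose valuation ring is `𝒪_v`, and `mem_localAbsIntegers_iff_spectralValuation`), hence `‖x‖ > 1 ↔ |x|_v > 1`.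
* §2 (B-a2) `some_mem_localKernelOfReduction_iff_of_isMinimal` — if `E ⊗ K_w` is ALREADY MINIMAL then `(x, y) ∈ E₁(K̄_w) ↔ |x|_w > 1` in the
  given coordinates (the chosen minimising change has `|u| = 1`, `|r| ≤ 1`, Silverman VII.1.3(b): `v_u_eq_one_and_v_r_le_one_of_isMinimal` +
  `one_lt_v_toX_iff`); `isMinimal_baseChange_adicCompletion_of_model` — `(W ⊗ K) ⊗ K_v = V ⊗ 𝒪_v` is integral with unit discriminant, hence
  minimal; ★ `some_mem_localKernelOfReduction_iff_of_model`.
* §3 ★ `eq_localKernelOfReduction_of_norm_criterion` — any subgroup with the norm criterion of p767396 IS `localKernelOfReduction v`.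
* §4 `hasGoodReductionAt_and_not_hasUnitRootAt_baseChange` — at `v ∣ p`, `W ⊗ K` has good, non-ordinary reduction when `W` is good at `p` with
  `p ∣ a_p(W)` (tree: `hasGoodReductionAt_baseChange_of_hasGoodReductionAt`, `not_dvd_frobeniusTrace_of_hasUnitRootAt_baseChange`).
The sequel `…RttCharRoadFormalModuleKernelStable` assembles these with p765177 / p767423 / p767396 into `hstab` for every `[b]` and the formal
`𝒪_{K_v}`-module on `localKernelOfReduction v` in the crux binders' currency.

References: [SilvermanAEC2009] VII.1.3(b), VII.2.1–2.2, V.3.1(a); [Kobayashi2003] Def. 1.1, §8; [KimPark2017] §2.2 Prop. 2.5, Prop. 2.12,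
Def. 3.13; [NeukirchANT1999] Ch. II (4.8), (6.2); [GreenbergLNM1716] §2 (pp. 82–83); [LubinTate1965] §1 Thm. 1, §2 Thm. 2.
-/

set_option autoImplicit false
-- D-0017: single-problem summit, the namespace repeats the problem name by design.
set_option linter.dupNamespace false
noncomputable section

open scoped Classical NumberField NNReal
open NumberField IsDedekindDomain Field ValuativeRel IsDedekindDomain.HeightOneSpectrum WeierstrassCurve PowerSeries
  Literature.NumberTheory.EllipticCurves Literature.NumberTheory.EllipticCurves.Kobayashi2003
  Literature.NumberTheory.EllipticCurves.Rank1Residual Literature.NumberTheory.NumberFields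
  Literature.NumberTheory.GaloisRepresentations Literature.NumberTheory.GaloisRepresentations.IsNonarchimedeanLocalField
  Literature.NumberTheory.GaloisRepresentations.LubinTate

namespace Summit.BirchSwinnertonDyer.BirchSwinnertonDyer.Theorems.SmallImageRttCharRoad

/-! ## §1 (B-a1) The spectral norm of the Lubin–Tate files and the spectral valuation `|·|_v` -/

section Norm

/- The norms below are those of the Lubin–Tate files (`LubinTateTorsion.lean`): `nF F` on a non-archimedean local field `F` (the valuation norm
of rank one, `rk1`) and `nE F E` (the spectral norm) on a finite subextension `E ⊆ F̄`.  They are `local instance`s there; here they are named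
EXPLICITLY in the statements (`@norm _ (nF F).toNorm`, `@norm _ (nE F E).toNorm`) so that no instance attribute is needed — on `K_v` Mathlib's own
norm `instNormedFieldValuedAdicCompletion` is a different (equivalent) absolute value. -/

/-- For the valuation norm `nF` of a non-archimedean local field: `‖y‖ ≤ 1 ↔ v(y) ≤ 1`. [cite: NeukirchANT1999, Ch. II (3.8)] -/
theorem ltNorm_le_one_iff_valuation_le_one {F : Type*} [Field F] [ValuativeRel F] [TopologicalSpace F]
    [IsNonarchimedeanLocalField F] (y : F) : @norm F (nF F).toNorm y ≤ 1 ↔ valuation F y ≤ 1 :=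
  @Valued.toNormedField.norm_le_one_iff F _ (ValueGroupWithZero F) _ (_) (rk1 F) y

variable {K : Type} [Field K] [NumberField K] (v : HeightOneSpectrum (𝓞 K))

/-- The valuation ring of the local norm `nF` on `K_v` is `𝓞_v = v.adicCompletionIntegers K` (the two integer rings of `K_v` agree,
`mem_integer_iff_mem_adicCompletionIntegers`). [cite: NeukirchANT1999, Ch. II §4 Prop. (4.1)] -/
theorem mem_adicCompletionIntegers_iff_ltNorm_le_one (y : v.adicCompletion K) :
    y ∈ v.adicCompletionIntegers K ↔ @norm _ (nF (v.adicCompletion K)).toNorm y ≤ 1 := by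
  rw [← mem_integer_iff_mem_adicCompletionIntegers, Valuation.mem_integer_iff]
  exact (ltNorm_le_one_iff_valuation_le_one y).symm

/-- **(B-a1) The closed unit balls agree.** For `x` in a finite subextension `E ⊆ K̄_v` of `K_v`: `‖x‖ ≤ 1` for the spectral norm `nE` of the
Lubin–Tate files (extending `nF`) iff `|x|_v ≤ 1` for the tree's `spectralValuation` (extending Mathlib's norm of `K_v`) — both say that `x` is
integral over `𝓞_v` (Neukirch II (4.8): the valuation ring of the extended absolute value is the integral closure;
`mem_absIntegers_iff_spectralNorm_le_one`, `mem_localAbsIntegers_iff_spectralValuation`). [cite: NeukirchANT1999, Ch. II Thm. (4.8), (6.2)] -/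
theorem norm_le_one_iff_spectralValuation_le_one
    (E : IntermediateField (v.adicCompletion K) (AlgebraicClosure (v.adicCompletion K))) [FiniteDimensional (v.adicCompletion K) E]
    (x : E) : @norm E (nE (v.adicCompletion K) E).toNorm x ≤ 1 ↔ v.spectralValuation (x : AlgebraicClosure (v.adicCompletion K)) ≤ 1 := by
  rw [show @norm E (nE (v.adicCompletion K) E).toNorm x =
      @spectralNorm (v.adicCompletion K) (nF (v.adicCompletion K)).toNormedField E _ _ x from norm_eq_spectralNorm (v.adicCompletion K) E x,
    @spectralNorm.eq_of_tower (v.adicCompletion K) (nF (v.adicCompletion K)).toNormedField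
      (AlgebraicClosure (v.adicCompletion K)) _ _ E _ _ _ _ x,
    ← @Literature.NumberTheory.GaloisRepresentations.mem_absIntegers_iff_spectralNorm_le_one (v.adicCompletion K)
      (nF (v.adicCompletion K)) (v.adicCompletionIntegers K) (mem_adicCompletionIntegers_iff_ltNorm_le_one v) _,
    ← mem_localAbsIntegers_iff_spectralValuation (coe_spectralValuation v)]
  rfl

/-- **(B-a1)** `‖x‖ > 1 ↔ |x|_v > 1` (negation of `norm_le_one_iff_spectralValuation_le_one`). [cite: NeukirchANT1999, Ch. II Thm. (4.8)] -/
theorem one_lt_norm_iff_one_lt_spectralValuation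
    (E : IntermediateField (v.adicCompletion K) (AlgebraicClosure (v.adicCompletion K))) [FiniteDimensional (v.adicCompletion K) E]
    (x : E) : 1 < @norm E (nE (v.adicCompletion K) E).toNorm x ↔ 1 < v.spectralValuation (x : AlgebraicClosure (v.adicCompletion K)) := by
  rw [← not_le, ← not_le, norm_le_one_iff_spectralValuation_le_one]

end Norm

/-! ## §2 (B-a2) The kernel of reduction in the coordinates of a minimal equation; minimality of `(W ⊗ K) ⊗ K_v` from the `ℤ_p`-model -/

section Minimal

variable {K : Type} [Field K] [NumberField K] (v : HeightOneSpectrum (𝓞 K))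

/-- **(B-a2) `E₁(K̄_w)` in the given coordinates of a MINIMAL equation.** If `E ⊗ K_w` is minimal at `w`, a point `(x, y) ∈ E(K̄_w)` lies in
the kernel of reduction `localKernelOfReduction w` iff `|x|_w > 1` — the chosen minimising change of variables `C_w` relates two minimal
equations, so `|u| = 1`, `|r| ≤ 1` (Silverman VII.1.3(b)) and `|C_w.toX x| > 1 ↔ |x| > 1`.
[cite: SilvermanAEC2009, Prop. VII.1.3(b) and Props. VII.2.1–2.2] -/
theorem some_mem_localKernelOfReduction_iff_of_isMinimal (E : WeierstrassCurve K) [E.IsElliptic] (w : HeightOneSpectrum (𝓞 K))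
    [hmin : (E.baseChange (w.adicCompletion K)).IsMinimal (w.adicCompletionIntegers K)]
    (x y : AlgebraicClosure (w.adicCompletion K))
    (hxy : (E.baseChange (AlgebraicClosure (w.adicCompletion K))).toAffine.Nonsingular x y) :
    (show localPoints E (w.adicCompletion K) from .some x y hxy) ∈ E.localKernelOfReduction w ↔ 1 < w.spectralValuation x := by
  rw [E.mem_localKernelOfReduction_some_iff w x y hxy]
  set X : WeierstrassCurve (w.adicCompletion K) := E.baseChange (w.adicCompletion K) with hX
  set C : VariableChange (w.adicCompletion K) := (X.exists_isMinimal (w.adicCompletionIntegers K)).choose with hC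
  haveI hminC : (C • X).IsMinimal (w.adicCompletionIntegers K) := (X.exists_isMinimal (w.adicCompletionIntegers K)).choose_spec
  haveI hmin1 : ((1 : VariableChange (w.adicCompletion K)) • X).IsMinimal (w.adicCompletionIntegers K) := by
    rw [one_smul]; exact hmin
  haveI : X.IsElliptic := inferInstanceAs ((E.map (algebraMap K (w.adicCompletion K))).IsElliptic)
  have hΔ : X.Δ ≠ 0 := X.isUnit_Δ.ne_zero
  have hVw := valued_le_one_iff_mem_range_adicCompletionIntegers (K := K) w
  obtain ⟨hu, hr⟩ := VariableChange.v_u_eq_one_and_v_r_le_one_of_isMinimal hVw X 1 C hΔ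
  rw [inv_one, mul_one] at hu hr
  have hsv := coe_spectralValuation w
  have huL : w.spectralValuation (((C.map (algebraMap (w.adicCompletion K) (AlgebraicClosure (w.adicCompletion K)))).u :
      AlgebraicClosure (w.adicCompletion K))) = 1 := by
    rw [VariableChange.map_u, Units.coe_map, MonoidHom.coe_coe]
    apply NNReal.coe_injective
    rw [coe_spectralValuation_algebraMap hsv, NumberField.FinitePlace.norm_def, hu, map_one]
  have hrL : w.spectralValuation ((C.map (algebraMap (w.adicCompletion K) (AlgebraicClosure (w.adicCompletion K)))).r) ≤ 1 := by
    rw [VariableChange.map_r, spectralValuation_algebraMap_le_one_iff hsv, mem_adicCompletionIntegers]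
    exact hr
  exact VariableChange.one_lt_v_toX_iff _ huL hrL x

variable {p : ℕ} [Fact p.Prime]

variable [Algebra ℚ_[p] (v.adicCompletion K)]

/-- `(W ⊗ K) ⊗ K_v` IS the base change of the `𝓞_v`-model `V ⊗_{ℤ_p} 𝓞_v` (along `padicIntToInteger` and
`integerEquivAdicCompletionIntegers`) when `V ⊗ K_v = W ⊗_ℚ K_v`. [cite: SilvermanAEC2009, VII.1] -/
theorem baseChange_adicCompletion_eq_model_baseChange (V : WeierstrassCurve ℤ_[p]) (W : WeierstrassCurve ℚ)
    (hVF : (V.map PadicInt.Coe.ringHom).map (algebraMap ℚ_[p] (v.adicCompletion K)) = W.map (algebraMap ℚ (v.adicCompletion K))) :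
    (W.baseChange K).baseChange (v.adicCompletion K) =
      (V.map (((integerEquivAdicCompletionIntegers v : 𝒪[v.adicCompletion K] ≃+* v.adicCompletionIntegers K) :
          𝒪[v.adicCompletion K] →+* v.adicCompletionIntegers K).comp (padicIntToInteger (v.adicCompletion K) p))).baseChange
        (v.adicCompletion K) := by
  have h1 : (W.baseChange K).baseChange (v.adicCompletion K) = W.map (algebraMap ℚ (v.adicCompletion K)) := by
    rw [WeierstrassCurve.baseChange, WeierstrassCurve.baseChange, map_map]
    exact congrArg W.map (Subsingleton.elim _ _)
  rw [h1, ← hVF, WeierstrassCurve.baseChange, map_map, map_map]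
  exact congrArg V.map (RingHom.ext fun a => rfl)

/-- **`(W ⊗ K) ⊗ K_v` is a minimal equation at `v`** when `W ⊗_ℚ K_v = V ⊗ K_v` for a `ℤ_p`-model `V` with elliptic special fibre: it is
`𝓞_v`-integral with unit discriminant (Silverman VII.1 Remark 1.1). [cite: SilvermanAEC2009, VII.1 Remark 1.1] -/
theorem isMinimal_baseChange_adicCompletion_of_model (V : WeierstrassCurve ℤ_[p]) [(V.map PadicInt.toZMod).IsElliptic]
    (W : WeierstrassCurve ℚ)
    (hVF : (V.map PadicInt.Coe.ringHom).map (algebraMap ℚ_[p] (v.adicCompletion K)) = W.map (algebraMap ℚ (v.adicCompletion K))) :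
    ((W.baseChange K).baseChange (v.adicCompletion K)).IsMinimal (v.adicCompletionIntegers K) := by
  set Vv : WeierstrassCurve (v.adicCompletionIntegers K) :=
    V.map (((integerEquivAdicCompletionIntegers v : 𝒪[v.adicCompletion K] ≃+* v.adicCompletionIntegers K) :
      𝒪[v.adicCompletion K] →+* v.adicCompletionIntegers K).comp (padicIntToInteger (v.adicCompletion K) p)) with hVv
  rw [baseChange_adicCompletion_eq_model_baseChange v V W hVF]
  haveI : (Vv.baseChange (v.adicCompletion K)).IsIntegral (v.adicCompletionIntegers K) := ⟨⟨Vv, rfl⟩⟩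
  refine isMinimal_of_valuation_Δ_eq_one _ ?_
  have hunit : IsUnit Vv.Δ := by
    rw [hVv, map_Δ]
    exact (Summit.BirchSwinnertonDyer.Rank1Residual.Additive.isUnit_Δ_of_isElliptic_toZMod p V).map _
  rw [WeierstrassCurve.baseChange, map_Δ, HeightOneSpectrum.valuation_of_algebraMap]
  refine le_antisymm (HeightOneSpectrum.intValuation_le_one _ _) (not_lt.mp fun hlt ↦ ?_)
  exact (IsLocalRing.mem_maximalIdeal _).mp ((HeightOneSpectrum.intValuation_lt_one_iff_mem _ _).mp hlt) hunit

/-- ★ **(B-a2) The kernel of reduction of `W ⊗ K` at `v` in `W`-COORDINATES**: when `W ⊗_ℚ K_v = V ⊗ K_v` for a `ℤ_p`-model `V` with elliptic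
special fibre, `(x, y) ∈ E₁(K̄_v) ↔ |x|_v > 1` for the coordinates of `(W ⊗ K) ⊗ K̄_v` themselves (no change of variables).
[cite: SilvermanAEC2009, VII.1 Remark 1.1, Prop. VII.1.3(b), Props. VII.2.1–2.2] -/
theorem some_mem_localKernelOfReduction_iff_of_model (V : WeierstrassCurve ℤ_[p]) [(V.map PadicInt.toZMod).IsElliptic]
    (W : WeierstrassCurve ℚ) [W.IsElliptic]
    (hVF : (V.map PadicInt.Coe.ringHom).map (algebraMap ℚ_[p] (v.adicCompletion K)) = W.map (algebraMap ℚ (v.adicCompletion K)))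
    (x y : AlgebraicClosure (v.adicCompletion K))
    (hxy : ((W.baseChange K).baseChange (AlgebraicClosure (v.adicCompletion K))).toAffine.Nonsingular x y) :
    (show localPoints (W.baseChange K) (v.adicCompletion K) from .some x y hxy) ∈ (W.baseChange K).localKernelOfReduction v ↔
      1 < v.spectralValuation x := by
  haveI := isMinimal_baseChange_adicCompletion_of_model v V W hVF
  haveI : (W.baseChange K).IsElliptic := by rw [WeierstrassCurve.baseChange]; infer_instance
  exact some_mem_localKernelOfReduction_iff_of_isMinimal (W.baseChange K) v x y hxy

end Minimal

/-! ## §3 A subgroup with the norm criterion is the kernel of reduction -/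

section Identify

variable {K : Type} [Field K] [NumberField K] (v : HeightOneSpectrum (𝓞 K)) {p : ℕ} [Fact p.Prime]
  [Algebra ℚ_[p] (v.adicCompletion K)]

/-- ★ **The formal points ARE the kernel of reduction.** A subgroup `E₁ ≤ E(K̄_v)` of the local points of `W ⊗ K` satisfying the norm criterion
of `exists_formalModule_localPoints_of_model` (every non-zero `Q ∈ E₁` is `(x, y)` with coordinates in a finite `E ⊆ K̄_v` and `‖x‖ > 1`, and
every such `(x, y)` lies in `E₁`) equals `localKernelOfReduction v`, provided `W ⊗_ℚ K_v = V ⊗ K_v` for a `ℤ_p`-model `V` with elliptic special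
fibre (so that `E₁(K̄_v)` is read in `W`-coordinates, `some_mem_localKernelOfReduction_iff_of_model`, and `‖x‖ > 1 ↔ |x|_v > 1`, §1).
[cite: SilvermanAEC2009, VII.2 Props. 2.1–2.2] [cite: NeukirchANT1999, Ch. II Thm. (4.8)] -/
theorem eq_localKernelOfReduction_of_norm_criterion (V : WeierstrassCurve ℤ_[p]) [(V.map PadicInt.toZMod).IsElliptic]
    (W : WeierstrassCurve ℚ) [W.IsElliptic]
    (hVF : (V.map PadicInt.Coe.ringHom).map (algebraMap ℚ_[p] (v.adicCompletion K)) = W.map (algebraMap ℚ (v.adicCompletion K)))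
    (E₁ : AddSubgroup (localPoints (W.baseChange K) (v.adicCompletion K)))
    (h₁ : ∀ Q ∈ E₁, Q ≠ 0 → ∃ (E : IntermediateField (v.adicCompletion K) (AlgebraicClosure (v.adicCompletion K)))
        (_ : FiniteDimensional (v.adicCompletion K) E) (x y : E)
        (hxy : ((W.baseChange K).baseChange (AlgebraicClosure (v.adicCompletion K))).toAffine.Nonsingular ↑x ↑y),
        Q = (Affine.Point.some _ _ hxy : localPoints (W.baseChange K) (v.adicCompletion K)) ∧ 1 < @norm E (nE (v.adicCompletion K) E).toNorm x)
    (h₂ : ∀ (E : IntermediateField (v.adicCompletion K) (AlgebraicClosure (v.adicCompletion K))) (_ : FiniteDimensional (v.adicCompletion K) E)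
        (x y : E) (hxy : ((W.baseChange K).baseChange (AlgebraicClosure (v.adicCompletion K))).toAffine.Nonsingular ↑x ↑y),
        1 < @norm E (nE (v.adicCompletion K) E).toNorm x →
          (Affine.Point.some _ _ hxy : localPoints (W.baseChange K) (v.adicCompletion K)) ∈ E₁) :
    E₁ = (W.baseChange K).localKernelOfReduction v := by
  ext Q
  constructor
  · intro hQ
    by_cases hQ0 : Q = 0
    · rw [hQ0]; exact AddSubgroup.zero_mem _
    obtain ⟨E, iE, x, y, hxy, rfl, hlt⟩ := h₁ Q hQ hQ0
    exact (some_mem_localKernelOfReduction_iff_of_model v V W hVF _ _ hxy).mpr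
      ((one_lt_norm_iff_one_lt_spectralValuation v E x).mp hlt)
  · intro hQ
    change ((W.baseChange K).baseChange (AlgebraicClosure (v.adicCompletion K))).toAffine.Point at Q
    rcases Q with _ | ⟨x, y, hxy⟩
    · exact E₁.zero_mem
    · have hx := (some_mem_localKernelOfReduction_iff_of_model v V W hVF x y hxy).mp hQ
      set E : IntermediateField (v.adicCompletion K) (AlgebraicClosure (v.adicCompletion K)) :=
        IntermediateField.adjoin (v.adicCompletion K) {x, y} with hE
      haveI : FiniteDimensional (v.adicCompletion K) E :=
        IntermediateField.finiteDimensional_adjoin_pair (Algebra.IsIntegral.isIntegral x) (Algebra.IsIntegral.isIntegral y)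
      have hxE : x ∈ E := IntermediateField.subset_adjoin _ _ (Set.mem_insert x {y})
      have hyE : y ∈ E := IntermediateField.subset_adjoin _ _ (Set.mem_insert_of_mem x rfl)
      exact h₂ E inferInstance ⟨x, hxE⟩ ⟨y, hyE⟩ hxy ((one_lt_norm_iff_one_lt_spectralValuation v E ⟨x, hxE⟩).mpr hx)

end Identify

/-! ## §4 Good supersingular reduction of `W ⊗ K` above `p` -/

section Reduction

variable {K : Type} [Field K] [NumberField K] (v : HeightOneSpectrum (𝓞 K)) {p : ℕ} [hp : Fact p.Prime]

/-- **`W ⊗ K` has good, NON-ordinary reduction at every `v ∣ p`** when `W/ℚ` (globally minimal) has good reduction at `p` with `p ∣ a_p(W)`: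
good reduction ascends (`hasGoodReductionAt_baseChange_of_hasGoodReductionAt`, Silverman VII.5.4(a)) and ordinarity would descend
(`not_dvd_frobeniusTrace_of_hasUnitRootAt_baseChange`: `a_w ≡ a_p^f (mod p)`). [cite: SilvermanAEC2009, VII.5 Prop. 5.4(a), V Ex. 5.10(a)]
[cite: GreenbergLNM1716, Thm 1.2 and §4 p. 103] -/
theorem hasGoodReductionAt_and_not_hasUnitRootAt_baseChange (W : WeierstrassCurve ℚ) [W.IsElliptic] [W.IsGloballyMinimal]
    (hgood : W.HasGoodReductionAtPrime p) (hap : (p : ℤ) ∣ W.frobeniusTrace p) (hpv : ((p : ℕ) : 𝓞 K) ∈ v.asIdeal) :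
    (W.baseChange K).HasGoodReductionAt v ∧ ¬ (W.baseChange K).HasUnitRootAt v := by
  set v₀ : HeightOneSpectrum (𝓞 ℚ) := (Rat.HeightOneSpectrum.primesEquiv (R := 𝓞 ℚ)).symm ⟨p, hp.out⟩ with hv₀
  have hpv₀ : ((p : ℕ) : 𝓞 ℚ) ∈ v₀.asIdeal := (natCast_mem_asIdeal_iff_eq_primesEquiv_symm v₀ hp.out).mpr hv₀
  haveI : v.asIdeal.LiesOver v₀.asIdeal :=
    ⟨(Summit.BirchSwinnertonDyer.Rank1Residual.Additive.under_eq_asIdeal_of_natCast_mem p v hpv).symm⟩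
  exact ⟨hasGoodReductionAt_baseChange_of_hasGoodReductionAt W K v₀ v (W.hasGoodReductionAt_of_hasGoodReductionAtPrime v₀ hpv₀ hgood),
    fun hunit ↦ SchneiderFreeAdditiveX3.QuadraticGoodReductionDescent.not_dvd_frobeniusTrace_of_hasUnitRootAt_baseChange W K hpv hgood hunit hap⟩

end Reduction

end Summit.BirchSwinnertonDyer.BirchSwinnertonDyer.Theorems.SmallImageRttCharRoad

end
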